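import Mathlib.Analysis.InnerProductSpace.Projection.Basic
import Mathlib.Topology.Algebra.Module.FiniteDimension
import Literature.MathematicalPhysics.QuantumFieldTheory.Balaban1983to89.B8CurlGradHolonomy
import HarnessLib

/-!
# Least-squares potentials: existence, Poincaré transfer, perturbed Poincaré constant, Lipschitz dependence on the operator

Helper letters (def-free, generic real inner-product spaces) for the LINE 28 candidate «gross-sd-transfer» of crux
`stmt-QuantumFields-19936` (`Summit.QuantumFields.YangMills.Theses.UnitScaleTilt.HistoryTailL`), card
`Cruxes/HistoryTailL/Ideas/gross-sd-transfer.md`, annexes `GrossTransferAnnex1/2/3.md`, and the located reading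
`LOCATE-LINE28-D2D3-COVARIANT-INFRA-w8g9.md` §3: the «covariant box Poincaré lemma in a hierarchically small background»
(D3) is there re-sized to (a) a FLAT degree-2 box Poincaré constant (the concrete tree-gauged least-squares potential,
pen (D3♭) `UnitScaleGibbsBoxLeastSquaresPotential`), (b) an operator bound `‖D_U − D_1‖ ≤ C·max_b dist₁(U_b)` on box
cochains, (c) a perturbation step; annex 1 §2 (ii′) needs the variation `∂_b u` of the `U`-DEPENDENT least-squares test
field `u = u(U)` along one link.  This file supplies the ABSTRACT linear algebra behind (a)–(c) and (ii′):

* §1 `exists_leastSquares`: for linear `D : V →ₗ[ℝ] W`, a subspace `T ≤ V` and every `h : W` there is `u ∈ T` with the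
  NORMAL EQUATIONS `⟪h − D u, D v⟫ = 0` for all `v ∈ T` and the Pythagorean identity `‖D u‖² + ‖h − D u‖² = ‖h‖²`
  (orthogonal projection of `h` onto the finite-dimensional subspace `T.map D`).
* §2 Poincaré ⇒ potential bound: `(∀ v ∈ T, ‖v‖ ≤ C‖D v‖) ⇒ ‖u‖ ≤ C‖h‖`; uniqueness of the least-squares potential in `T`.
* §3 perturbed Poincaré constant (one triangle inequality): `‖v‖ ≤ C₀‖d v‖` and `‖D v − d v‖ ≤ ε‖v‖` on `T` with
  `C₀ε < 1` give `‖v‖ ≤ C₀/(1 − C₀ε)·‖D v‖` on `T` (and `2C₀` when `C₀ε ≤ 1/2`).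
* §4 Lipschitz dependence of the least-squares potential on the operator: with a common Poincaré constant `C` for
  `D₁, D₂` on `T` and `‖D₁ v − D₂ v‖ ≤ η‖v‖` on `T`, the two potentials of the same `h` satisfy `‖u₁ − u₂‖ ≤ 2C²η‖h‖`
  and `‖D₁ u₁ − D₂ u₂‖ ≤ 3Cη‖h‖` — no bound on `‖D_i‖` is needed.
* §5 the pointwise letter behind (b) on the tree carrier `B8CurlGradHolonomy.covD/covCurl`: if every transporter moves
  vectors by at most `κ`, `‖m • v − v‖ ≤ κ m · ‖v‖` (for the adjoint action `κ m = 2‖m − 1‖`, ✓`norm_conj_sub_le`), then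
  the covariant derivative / curl differ from the flat ones by `κ`-weighted values of the field.

HONEST: generic finite-dimensional linear algebra and two norm inequalities; proves nothing of D3, S_test, S_dom,
«ShallowFluxSecondMomentL», (Q), K1, `MeanDeviationL`, `HistoryTailL`, or any crux / rung statement; LINE 28 is an idea
(critic #323), not a registered line; rung R3 = YM₃ on T³ — NOT d = 4, NOT infinite volume, NOT a mass gap, NOT Clay.
-/

set_option autoImplicit false

namespace Summit.QuantumFields.YangMills.Theorems.UnitScaleGibbsLeastSquaresPerturbationLetters

open RealInnerProductSpace

section LeastSquares

variable {V W : Type*} [NormedAddCommGroup V] [InnerProductSpace ℝ V]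
  [NormedAddCommGroup W] [InnerProductSpace ℝ W]

/-! ## §1 Least squares onto the image of a subspace -/

/-- **Least-squares potential.**  For a linear map `D`, a subspace `T` and a datum `h` in a finite-dimensional target
there is `u ∈ T` minimising `‖h − D u‖`: it satisfies the normal equations against every `D v`, `v ∈ T`, and the
Pythagorean identity `‖D u‖² + ‖h − D u‖² = ‖h‖²` (orthogonal projection onto `T.map D`). [folklore] -/
theorem exists_leastSquares [FiniteDimensional ℝ W] (D : V →ₗ[ℝ] W) (T : Submodule ℝ V) (h : W) :
    ∃ u ∈ T, (∀ v ∈ T, ⟪h - D u, D v⟫ = 0) ∧ ‖D u‖ ^ 2 + ‖h - D u‖ ^ 2 = ‖h‖ ^ 2 := by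
  let K : Submodule ℝ W := T.map D
  haveI : CompleteSpace K := FiniteDimensional.complete ℝ K
  have hmem : K.starProjection h ∈ K := K.starProjection_apply_mem h
  obtain ⟨u, huT, hu⟩ := Submodule.mem_map.mp hmem
  have hne : ∀ v ∈ T, ⟪h - D u, D v⟫ = 0 := by
    intro v hv
    have hDv : D v ∈ K := Submodule.mem_map_of_mem hv
    rw [hu]
    exact K.starProjection_inner_eq_zero h (D v) hDv
  refine ⟨u, huT, hne, ?_⟩
  have horth : ⟪D u, h - D u⟫ = 0 := by
    rw [real_inner_comm]
    exact hne u huT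
  have hsplit : h = D u + (h - D u) := by abel
  calc ‖D u‖ ^ 2 + ‖h - D u‖ ^ 2
      = ‖D u‖ ^ 2 + 2 * ⟪D u, h - D u⟫ + ‖h - D u‖ ^ 2 := by rw [horth]; ring
    _ = ‖D u + (h - D u)‖ ^ 2 := (norm_add_sq_real _ _).symm
    _ = ‖h‖ ^ 2 := by rw [← hsplit]

/-- The two norm inequalities contained in the Pythagorean identity: the least-squares image and the residual are both
bounded by the datum. [folklore] -/
theorem norm_le_of_pythagoras {a b c : ℝ} (hc : 0 ≤ c)
    (h : a ^ 2 + b ^ 2 = c ^ 2) : a ≤ c ∧ b ≤ c := by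
  constructor
  · nlinarith [sq_nonneg b, sq_nonneg (a - c), sq_nonneg (a + c)]
  · nlinarith [sq_nonneg a, sq_nonneg (b - c), sq_nonneg (b + c)]

/-! ## §2 A Poincaré inequality on `T` bounds the potential by the datum -/

/-- **Poincaré ⇒ potential bound.**  If `‖v‖ ≤ C‖D v‖` on `T` (`0 ≤ C`) and `u ∈ T` satisfies the Pythagorean identity
of §1, then `‖D u‖ ≤ ‖h‖`, `‖h − D u‖ ≤ ‖h‖` and `‖u‖ ≤ C‖h‖`. [folklore] -/
theorem norm_potential_le (D : V →ₗ[ℝ] W) (T : Submodule ℝ V) {C : ℝ} (hC : 0 ≤ C)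
    (hP : ∀ v ∈ T, ‖v‖ ≤ C * ‖D v‖) {h : W} {u : V} (hu : u ∈ T)
    (hpy : ‖D u‖ ^ 2 + ‖h - D u‖ ^ 2 = ‖h‖ ^ 2) :
    ‖D u‖ ≤ ‖h‖ ∧ ‖h - D u‖ ≤ ‖h‖ ∧ ‖u‖ ≤ C * ‖h‖ := by
  obtain ⟨h1, h2⟩ := norm_le_of_pythagoras (norm_nonneg _) hpy
  exact ⟨h1, h2, (hP u hu).trans (mul_le_mul_of_nonneg_left h1 hC)⟩

/-- **Existence with constant** (§1 + §2 packaged): under a Poincaré inequality with constant `C ≥ 0` on `T`, every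
datum `h` has a least-squares potential `u ∈ T` with the normal equations, `‖D u‖ ≤ ‖h‖`, `‖h − D u‖ ≤ ‖h‖` and
`‖u‖ ≤ C‖h‖`. [folklore] -/
theorem exists_leastSquares_norm_le [FiniteDimensional ℝ W] (D : V →ₗ[ℝ] W) (T : Submodule ℝ V) {C : ℝ}
    (hC : 0 ≤ C) (hP : ∀ v ∈ T, ‖v‖ ≤ C * ‖D v‖) (h : W) :
    ∃ u ∈ T, (∀ v ∈ T, ⟪h - D u, D v⟫ = 0) ∧ ‖D u‖ ^ 2 + ‖h - D u‖ ^ 2 = ‖h‖ ^ 2 ∧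
      ‖D u‖ ≤ ‖h‖ ∧ ‖h - D u‖ ≤ ‖h‖ ∧ ‖u‖ ≤ C * ‖h‖ := by
  obtain ⟨u, huT, hne, hpy⟩ := exists_leastSquares D T h
  exact ⟨u, huT, hne, hpy, norm_potential_le D T hC hP huT hpy⟩

/-- The normal equations determine the IMAGE `D u` (two solutions in `T` have the same image). [folklore] -/
theorem map_eq_of_normalEquations (D : V →ₗ[ℝ] W) (T : Submodule ℝ V) {h : W} {u₁ u₂ : V}
    (hu₁ : u₁ ∈ T) (hu₂ : u₂ ∈ T) (hne₁ : ∀ v ∈ T, ⟪h - D u₁, D v⟫ = 0)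
    (hne₂ : ∀ v ∈ T, ⟪h - D u₂, D v⟫ = 0) : D u₁ = D u₂ := by
  have hw : u₁ - u₂ ∈ T := T.sub_mem hu₁ hu₂
  have e₁ := hne₁ (u₁ - u₂) hw
  have e₂ := hne₂ (u₁ - u₂) hw
  have hsub : (h - D u₂) - (h - D u₁) = D (u₁ - u₂) := by rw [map_sub]; abel
  have hsq : ⟪D (u₁ - u₂), D (u₁ - u₂)⟫ = 0 := by
    calc ⟪D (u₁ - u₂), D (u₁ - u₂)⟫ = ⟪(h - D u₂) - (h - D u₁), D (u₁ - u₂)⟫ := by rw [hsub]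
      _ = ⟪h - D u₂, D (u₁ - u₂)⟫ - ⟪h - D u₁, D (u₁ - u₂)⟫ := inner_sub_left _ _ _
      _ = 0 := by rw [e₁, e₂, sub_zero]
  have hz : D (u₁ - u₂) = 0 := inner_self_eq_zero.mp hsq
  rw [map_sub] at hz
  exact sub_eq_zero.mp hz

/-- **Uniqueness of the potential** under a Poincaré inequality on `T` (which makes `D` injective on `T`). [folklore] -/
theorem eq_of_normalEquations (D : V →ₗ[ℝ] W) (T : Submodule ℝ V) {C : ℝ}
    (hP : ∀ v ∈ T, ‖v‖ ≤ C * ‖D v‖) {h : W} {u₁ u₂ : V}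
    (hu₁ : u₁ ∈ T) (hu₂ : u₂ ∈ T) (hne₁ : ∀ v ∈ T, ⟪h - D u₁, D v⟫ = 0)
    (hne₂ : ∀ v ∈ T, ⟪h - D u₂, D v⟫ = 0) : u₁ = u₂ := by
  have himg := map_eq_of_normalEquations D T hu₁ hu₂ hne₁ hne₂
  have hw : u₁ - u₂ ∈ T := T.sub_mem hu₁ hu₂
  have hb := hP (u₁ - u₂) hw
  rw [map_sub, himg, sub_self, norm_zero, mul_zero] at hb
  exact sub_eq_zero.mp (norm_eq_zero.mp (le_antisymm hb (norm_nonneg _)))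

/-! ## §3 Perturbation of the Poincaré constant -/

/-- **Perturbed Poincaré constant.**  A Poincaré inequality `‖v‖ ≤ C₀‖d v‖` on `T` for a reference operator `d`
survives a perturbation `D` with `‖D v − d v‖ ≤ ε‖v‖` on `T` as long as `C₀ε < 1`, with constant `C₀/(1 − C₀ε)`.
(One triangle inequality; this is the «Neumann series» step (c) of the located reading, no series needed.) [folklore] -/
theorem poincare_of_perturbation (d D : V →ₗ[ℝ] W) (T : Submodule ℝ V) {C₀ ε : ℝ} (hC₀ : 0 ≤ C₀)
    (hP : ∀ v ∈ T, ‖v‖ ≤ C₀ * ‖d v‖) (hE : ∀ v ∈ T, ‖D v - d v‖ ≤ ε * ‖v‖) (hε : C₀ * ε < 1) :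
    ∀ v ∈ T, ‖v‖ ≤ C₀ / (1 - C₀ * ε) * ‖D v‖ := by
  intro v hv
  have h1 : ‖d v‖ ≤ ‖D v‖ + ‖D v - d v‖ := by
    calc ‖d v‖ = ‖D v - (D v - d v)‖ := by rw [sub_sub_cancel]
      _ ≤ ‖D v‖ + ‖D v - d v‖ := norm_sub_le _ _
  have h2 : ‖v‖ ≤ C₀ * ‖D v‖ + C₀ * ε * ‖v‖ := by
    calc ‖v‖ ≤ C₀ * ‖d v‖ := hP v hv
      _ ≤ C₀ * (‖D v‖ + ε * ‖v‖) := by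
          exact mul_le_mul_of_nonneg_left (h1.trans (by linarith [hE v hv])) hC₀
      _ = C₀ * ‖D v‖ + C₀ * ε * ‖v‖ := by ring
  have hpos : 0 < 1 - C₀ * ε := by linarith
  rw [div_mul_eq_mul_div, le_div_iff₀ hpos]
  nlinarith [h2]

/-- The `C₀ε ≤ 1/2` form: the Poincaré constant at most doubles. [folklore] -/
theorem poincare_of_perturbation_half (d D : V →ₗ[ℝ] W) (T : Submodule ℝ V) {C₀ ε : ℝ} (hC₀ : 0 ≤ C₀)
    (hP : ∀ v ∈ T, ‖v‖ ≤ C₀ * ‖d v‖) (hE : ∀ v ∈ T, ‖D v - d v‖ ≤ ε * ‖v‖) (hε : C₀ * ε ≤ 1 / 2) :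
    ∀ v ∈ T, ‖v‖ ≤ 2 * C₀ * ‖D v‖ := by
  intro v hv
  have h := poincare_of_perturbation d D T hC₀ hP hE (by linarith) v hv
  have hpos : 0 < 1 - C₀ * ε := by linarith
  have hle : C₀ / (1 - C₀ * ε) ≤ 2 * C₀ := by
    rw [div_le_iff₀ hpos]; nlinarith
  exact h.trans (mul_le_mul_of_nonneg_right hle (norm_nonneg _))

/-- An operator-norm form of the perturbation hypothesis: if `D − d` restricted to `T` is bounded by `ε` pointwise on
a spanning description, namely `‖(D − d) v‖ ≤ ε‖v‖` for all `v` (not only on `T`), the hypothesis of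
`poincare_of_perturbation` holds. [folklore] -/
theorem perturbation_on_subspace_of_global (d D : V →ₗ[ℝ] W) (T : Submodule ℝ V) {ε : ℝ}
    (hE : ∀ v : V, ‖D v - d v‖ ≤ ε * ‖v‖) : ∀ v ∈ T, ‖D v - d v‖ ≤ ε * ‖v‖ :=
  fun v _ => hE v

/-! ## §4 Lipschitz dependence of the least-squares potential on the operator -/

/-- **Lipschitz dependence on the operator (image form).**  Two least-squares solutions `u₁, u₂ ∈ T` of the same datum
`h` for operators `D₁, D₂` with `‖D₁ v − D₂ v‖ ≤ η‖v‖` on `T`, a Poincaré constant `C` for `D₁` on `T`, and the a priori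
bounds `‖h − D₂ u₂‖ ≤ ‖h‖`, `‖u₂‖ ≤ C‖h‖` of §2, satisfy `‖D₁ (u₁ − u₂)‖ ≤ 2Cη‖h‖`. [folklore] -/
theorem norm_map_sub_le_of_normalEquations (D₁ D₂ : V →ₗ[ℝ] W) (T : Submodule ℝ V) {C η : ℝ}
    (hC : 0 ≤ C) (hη : 0 ≤ η) (hP₁ : ∀ v ∈ T, ‖v‖ ≤ C * ‖D₁ v‖)
    (hD : ∀ v ∈ T, ‖D₁ v - D₂ v‖ ≤ η * ‖v‖) {h : W} {u₁ u₂ : V} (hu₁ : u₁ ∈ T) (hu₂ : u₂ ∈ T)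
    (hne₁ : ∀ v ∈ T, ⟪h - D₁ u₁, D₁ v⟫ = 0) (hne₂ : ∀ v ∈ T, ⟪h - D₂ u₂, D₂ v⟫ = 0)
    (hres₂ : ‖h - D₂ u₂‖ ≤ ‖h‖) (hpot₂ : ‖u₂‖ ≤ C * ‖h‖) :
    ‖D₁ (u₁ - u₂)‖ ≤ 2 * C * η * ‖h‖ := by
  set w := u₁ - u₂ with hw_def
  have hw : w ∈ T := T.sub_mem hu₁ hu₂
  -- the key identity: ‖D₁ w‖² = ⟪h − D₂ u₂, D₁ w − D₂ w⟫ + ⟪D₂ u₂ − D₁ u₂, D₁ w⟫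
  have e₁ : ⟪h - D₁ u₁, D₁ w⟫ = 0 := hne₁ w hw
  have e₂ : ⟪h - D₂ u₂, D₂ w⟫ = 0 := hne₂ w hw
  have hid : ‖D₁ w‖ ^ 2 = ⟪h - D₂ u₂, D₁ w - D₂ w⟫ + ⟪D₂ u₂ - D₁ u₂, D₁ w⟫ := by
    have hDw : D₁ w = D₁ u₁ - D₁ u₂ := by rw [hw_def, map_sub]
    rw [← real_inner_self_eq_norm_sq]
    have step1 : ⟪D₁ w, D₁ w⟫ = ⟪h - D₁ u₂, D₁ w⟫ := by
      have hsub : (h - D₁ u₂) - (h - D₁ u₁) = D₁ w := by rw [hDw]; abel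
      calc ⟪D₁ w, D₁ w⟫ = ⟪(h - D₁ u₂) - (h - D₁ u₁), D₁ w⟫ := by rw [hsub]
        _ = ⟪h - D₁ u₂, D₁ w⟫ - ⟪h - D₁ u₁, D₁ w⟫ := inner_sub_left _ _ _
        _ = ⟪h - D₁ u₂, D₁ w⟫ := by rw [e₁, sub_zero]
    have step2 : ⟪h - D₁ u₂, D₁ w⟫ = ⟪h - D₂ u₂, D₁ w⟫ + ⟪D₂ u₂ - D₁ u₂, D₁ w⟫ := by
      rw [← inner_add_left]; congr 1; abel
    have step3 : ⟪h - D₂ u₂, D₁ w⟫ = ⟪h - D₂ u₂, D₁ w - D₂ w⟫ := by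
      rw [inner_sub_right, e₂, sub_zero]
    rw [step1, step2, step3]
  -- estimate the two terms
  have t1 : ⟪h - D₂ u₂, D₁ w - D₂ w⟫ ≤ ‖h‖ * (η * ‖w‖) :=
    (real_inner_le_norm _ _).trans (mul_le_mul hres₂ (hD w hw) (norm_nonneg _) (norm_nonneg _))
  have t2 : ⟪D₂ u₂ - D₁ u₂, D₁ w⟫ ≤ η * (C * ‖h‖) * ‖D₁ w‖ := by
    refine (real_inner_le_norm _ _).trans (mul_le_mul_of_nonneg_right ?_ (norm_nonneg _))
    calc ‖D₂ u₂ - D₁ u₂‖ = ‖D₁ u₂ - D₂ u₂‖ := norm_sub_rev _ _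
      _ ≤ η * ‖u₂‖ := hD u₂ hu₂
      _ ≤ η * (C * ‖h‖) := mul_le_mul_of_nonneg_left hpot₂ hη
  have hwP : ‖w‖ ≤ C * ‖D₁ w‖ := hP₁ w hw
  have hsq : ‖D₁ w‖ ^ 2 ≤ 2 * C * η * ‖h‖ * ‖D₁ w‖ := by
    have hh : 0 ≤ ‖h‖ := norm_nonneg h
    calc ‖D₁ w‖ ^ 2 = ⟪h - D₂ u₂, D₁ w - D₂ w⟫ + ⟪D₂ u₂ - D₁ u₂, D₁ w⟫ := hid
      _ ≤ ‖h‖ * (η * ‖w‖) + η * (C * ‖h‖) * ‖D₁ w‖ := add_le_add t1 t2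
      _ ≤ ‖h‖ * (η * (C * ‖D₁ w‖)) + η * (C * ‖h‖) * ‖D₁ w‖ := by
          gcongr
      _ = 2 * C * η * ‖h‖ * ‖D₁ w‖ := by ring
  have hK : 0 ≤ 2 * C * η * ‖h‖ := by positivity
  by_cases hz : ‖D₁ w‖ = 0
  · rw [hz]; exact hK
  · have hpos : 0 < ‖D₁ w‖ := lt_of_le_of_ne (norm_nonneg _) (Ne.symm hz)
    rw [pow_two] at hsq
    exact le_of_mul_le_mul_right hsq hpos

/-- **Lipschitz dependence on the operator (potential form).**  Under the hypotheses of
`norm_map_sub_le_of_normalEquations`, `‖u₁ − u₂‖ ≤ 2C²η‖h‖`. [folklore] -/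
theorem norm_sub_le_of_normalEquations (D₁ D₂ : V →ₗ[ℝ] W) (T : Submodule ℝ V) {C η : ℝ}
    (hC : 0 ≤ C) (hη : 0 ≤ η) (hP₁ : ∀ v ∈ T, ‖v‖ ≤ C * ‖D₁ v‖)
    (hD : ∀ v ∈ T, ‖D₁ v - D₂ v‖ ≤ η * ‖v‖) {h : W} {u₁ u₂ : V} (hu₁ : u₁ ∈ T) (hu₂ : u₂ ∈ T)
    (hne₁ : ∀ v ∈ T, ⟪h - D₁ u₁, D₁ v⟫ = 0) (hne₂ : ∀ v ∈ T, ⟪h - D₂ u₂, D₂ v⟫ = 0)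
    (hres₂ : ‖h - D₂ u₂‖ ≤ ‖h‖) (hpot₂ : ‖u₂‖ ≤ C * ‖h‖) :
    ‖u₁ - u₂‖ ≤ 2 * C ^ 2 * η * ‖h‖ := by
  have himg := norm_map_sub_le_of_normalEquations D₁ D₂ T hC hη hP₁ hD hu₁ hu₂ hne₁ hne₂ hres₂ hpot₂
  calc ‖u₁ - u₂‖ ≤ C * ‖D₁ (u₁ - u₂)‖ := hP₁ _ (T.sub_mem hu₁ hu₂)
    _ ≤ C * (2 * C * η * ‖h‖) := mul_le_mul_of_nonneg_left himg hC
    _ = 2 * C ^ 2 * η * ‖h‖ := by ring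

/-- **Lipschitz dependence on the operator (fitted-value form).**  Under the same hypotheses,
`‖D₁ u₁ − D₂ u₂‖ ≤ 3Cη‖h‖`. [folklore] -/
theorem norm_fit_sub_le_of_normalEquations (D₁ D₂ : V →ₗ[ℝ] W) (T : Submodule ℝ V) {C η : ℝ}
    (hC : 0 ≤ C) (hη : 0 ≤ η) (hP₁ : ∀ v ∈ T, ‖v‖ ≤ C * ‖D₁ v‖)
    (hD : ∀ v ∈ T, ‖D₁ v - D₂ v‖ ≤ η * ‖v‖) {h : W} {u₁ u₂ : V} (hu₁ : u₁ ∈ T) (hu₂ : u₂ ∈ T)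
    (hne₁ : ∀ v ∈ T, ⟪h - D₁ u₁, D₁ v⟫ = 0) (hne₂ : ∀ v ∈ T, ⟪h - D₂ u₂, D₂ v⟫ = 0)
    (hres₂ : ‖h - D₂ u₂‖ ≤ ‖h‖) (hpot₂ : ‖u₂‖ ≤ C * ‖h‖) :
    ‖D₁ u₁ - D₂ u₂‖ ≤ 3 * C * η * ‖h‖ := by
  have himg := norm_map_sub_le_of_normalEquations D₁ D₂ T hC hη hP₁ hD hu₁ hu₂ hne₁ hne₂ hres₂ hpot₂
  have hsplit : D₁ u₁ - D₂ u₂ = D₁ (u₁ - u₂) + (D₁ u₂ - D₂ u₂) := by rw [map_sub]; abel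
  calc ‖D₁ u₁ - D₂ u₂‖ = ‖D₁ (u₁ - u₂) + (D₁ u₂ - D₂ u₂)‖ := by rw [hsplit]
    _ ≤ ‖D₁ (u₁ - u₂)‖ + ‖D₁ u₂ - D₂ u₂‖ := norm_add_le _ _
    _ ≤ 2 * C * η * ‖h‖ + η * (C * ‖h‖) :=
        add_le_add himg ((hD u₂ hu₂).trans (mul_le_mul_of_nonneg_left hpot₂ hη))
    _ = 3 * C * η * ‖h‖ := by ring

/-- **The least-squares potential is Lipschitz in the operator** (§1 + §2 + §4 packaged, symmetric hypotheses): if both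
`D₁` and `D₂` satisfy the Poincaré inequality with constant `C ≥ 0` on `T` and differ by at most `η ≥ 0` on `T`, then
ANY two least-squares potentials `u₁, u₂ ∈ T` of the same datum `h` (normal equations + Pythagorean identity, as
produced by `exists_leastSquares`) satisfy `‖u₁ − u₂‖ ≤ 2C²η‖h‖` and `‖D₁ u₁ − D₂ u₂‖ ≤ 3Cη‖h‖`. [folklore] -/
theorem leastSquares_lipschitz (D₁ D₂ : V →ₗ[ℝ] W) (T : Submodule ℝ V) {C η : ℝ}
    (hC : 0 ≤ C) (hη : 0 ≤ η) (hP₁ : ∀ v ∈ T, ‖v‖ ≤ C * ‖D₁ v‖) (hP₂ : ∀ v ∈ T, ‖v‖ ≤ C * ‖D₂ v‖)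
    (hD : ∀ v ∈ T, ‖D₁ v - D₂ v‖ ≤ η * ‖v‖) {h : W} {u₁ u₂ : V} (hu₁ : u₁ ∈ T) (hu₂ : u₂ ∈ T)
    (hne₁ : ∀ v ∈ T, ⟪h - D₁ u₁, D₁ v⟫ = 0) (hpy₁ : ‖D₁ u₁‖ ^ 2 + ‖h - D₁ u₁‖ ^ 2 = ‖h‖ ^ 2)
    (hne₂ : ∀ v ∈ T, ⟪h - D₂ u₂, D₂ v⟫ = 0) (hpy₂ : ‖D₂ u₂‖ ^ 2 + ‖h - D₂ u₂‖ ^ 2 = ‖h‖ ^ 2) :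
    ‖u₁ - u₂‖ ≤ 2 * C ^ 2 * η * ‖h‖ ∧ ‖D₁ u₁ - D₂ u₂‖ ≤ 3 * C * η * ‖h‖ := by
  have _h1 := norm_potential_le D₁ T hC hP₁ hu₁ hpy₁
  obtain ⟨-, hres₂, hpot₂⟩ := norm_potential_le D₂ T hC hP₂ hu₂ hpy₂
  exact ⟨norm_sub_le_of_normalEquations D₁ D₂ T hC hη hP₁ hD hu₁ hu₂ hne₁ hne₂ hres₂ hpot₂,
    norm_fit_sub_le_of_normalEquations D₁ D₂ T hC hη hP₁ hD hu₁ hu₂ hne₁ hne₂ hres₂ hpot₂⟩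

end LeastSquares

/-! ## §5 The pointwise letter behind the operator bound `‖D_U − D_1‖ ≤ C·max_b dist₁(U_b)` -/

section Covariant

open Literature.MathematicalPhysics.QuantumFieldTheory.Balaban1983to89.B8CurlGradHolonomy

variable {S M E : Type*} [Monoid M] [NormedAddCommGroup E] [DistribMulAction M E]

/-- **Covariant minus flat derivative, pointwise.**  If every transporter `m` moves vectors by at most `κ m` times
their norm (`‖m • v − v‖ ≤ κ m·‖v‖`; for B9's adjoint action `R(U)X = UXU⁻¹` one has `κ U = 2‖U − 1‖`,
✓`B8CurlGradHolonomy.norm_conj_sub_le`), then the covariant derivative of a site field along `⟨x, s x⟩` differs from the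
flat one by at most `κ (U x)·‖f (s x)‖`. [folklore] -/
theorem norm_covD_sub_covD_one_le (κ : M → ℝ) (hκ : ∀ (m : M) (v : E), ‖m • v - v‖ ≤ κ m * ‖v‖)
    (s : S → S) (U : S → M) (f : S → E) (x : S) :
    ‖covD s U f x - covD s (fun _ => (1 : M)) f x‖ ≤ κ (U x) * ‖f (s x)‖ := by
  rw [covD_apply, covD_apply, one_smul]
  have : U x • f (s x) - f x - (f (s x) - f x) = U x • f (s x) - f (s x) := by abel
  rw [this]
  exact hκ (U x) (f (s x))

/-- **Covariant minus flat curl, pointwise** (B9 (3.4) second form): the covariant curl of a bond field on the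
plaquette `p_{μν}(x)` differs from the flat curl by at most `κ (Uμ x)·‖Aν (sμ x)‖ + κ (Uν x)·‖Aμ (sν x)‖` — so on a
box where every transporter has `κ ≤ ε₀` the difference operator is bounded by `2ε₀` times the sup of the field on the
plaquette's bonds (the letter (b) of the located reading, with `ε₀ = C·n·θ(K)` in the axial gauge of a `17L^j`-box by
✓`T4AxialGaugeSmallField.dist1_gaugeAct_axialGauge_le_uniform`). [folklore] -/
theorem norm_covCurl_sub_covCurl_one_le (κ : M → ℝ) (hκ : ∀ (m : M) (v : E), ‖m • v - v‖ ≤ κ m * ‖v‖)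
    (sμ sν : S → S) (Uμ Uν : S → M) (Aμ Aν : S → E) (x : S) :
    ‖covCurl sμ sν Uμ Uν Aμ Aν x - covCurl sμ sν (fun _ => (1 : M)) (fun _ => (1 : M)) Aμ Aν x‖
      ≤ κ (Uμ x) * ‖Aν (sμ x)‖ + κ (Uν x) * ‖Aμ (sν x)‖ := by
  have hsplit : covCurl sμ sν Uμ Uν Aμ Aν x - covCurl sμ sν (fun _ => (1 : M)) (fun _ => (1 : M)) Aμ Aν x
      = (covD sμ Uμ Aν x - covD sμ (fun _ => (1 : M)) Aν x)
        - (covD sν Uν Aμ x - covD sν (fun _ => (1 : M)) Aμ x) := by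
    simp only [covCurl_apply, covD_apply]
    abel
  rw [hsplit]
  exact (norm_sub_le _ _).trans
    (add_le_add (norm_covD_sub_covD_one_le κ hκ sμ Uμ Aν x) (norm_covD_sub_covD_one_le κ hκ sν Uν Aμ x))

/-- **Uniform form on a region.**  If `κ (U b) ≤ ε₀` for the transporters of both bonds at `x` and the field is bounded
by `a` on the two shifted sites, the curl difference at `x` is at most `2ε₀a`. [folklore] -/
theorem norm_covCurl_sub_covCurl_one_le_uniform (κ : M → ℝ)
    (hκ : ∀ (m : M) (v : E), ‖m • v - v‖ ≤ κ m * ‖v‖)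
    (sμ sν : S → S) (Uμ Uν : S → M) (Aμ Aν : S → E) (x : S) {ε₀ a : ℝ} (hε₀ : 0 ≤ ε₀)
    (hμ : κ (Uμ x) ≤ ε₀) (hν : κ (Uν x) ≤ ε₀) (hAν : ‖Aν (sμ x)‖ ≤ a) (hAμ : ‖Aμ (sν x)‖ ≤ a) :
    ‖covCurl sμ sν Uμ Uν Aμ Aν x - covCurl sμ sν (fun _ => (1 : M)) (fun _ => (1 : M)) Aμ Aν x‖
      ≤ 2 * ε₀ * a := by
  have h := norm_covCurl_sub_covCurl_one_le κ hκ sμ sν Uμ Uν Aμ Aν x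
  have t1 : κ (Uμ x) * ‖Aν (sμ x)‖ ≤ ε₀ * a :=
    (mul_le_mul_of_nonneg_right hμ (norm_nonneg _)).trans (mul_le_mul_of_nonneg_left hAν hε₀)
  have t2 : κ (Uν x) * ‖Aμ (sν x)‖ ≤ ε₀ * a :=
    (mul_le_mul_of_nonneg_right hν (norm_nonneg _)).trans (mul_le_mul_of_nonneg_left hAμ hε₀)
  linarith

end Covariant

end Summit.QuantumFields.YangMills.Theorems.UnitScaleGibbsLeastSquaresPerturbationLetters
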